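import Literature.NumberTheory.LFunctions.KMVPrimeAveragedSecondSqueeze
import Summits.Parity.GeneralizedHardyLittlewood.Theses.PrimeLevelFamEdge
import Summits.Parity.GeneralizedHardyLittlewood.Theorems.BeyondDiagonalBeatsQuarter.MollifierMainTermXSq
import HarnessLib

/-!
# K_B from the prime-averaged SECOND-moment display at `(X², 1)` — line `prime-averaged-squeeze`, Summits side

Supports stmt-Parity-20343 (`BeyondDiagonalBeatsQuarter`, route `PrimeLevelFamEdge` rev 3; D-0130 line A,
seat ls-Bfam-prover-2). The registered stub A of `Cruxes/BeyondDiagonalBeatsQuarter/Lines/prime-averaged-squeeze.lean`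
— «on some window `(1, b)` the mollified second harmonic moment at `(P, Q) = (X², 1)`, length `q̂^{Δ'}`, is
diagonal-only to relative `o(1)` on average over the good primes of dyadic blocks» (the SECOND-defect half
of the card's `C⁺ = KMV2000.PrimeAveragedDiagOnly 1 b`, p523798) — gives the VALUE crux: the crux's
antecedent (Bettin 2017 Thm 1.1) with the landed `X²` main term (`stub_mollifierMainTermXSq`, p526832) pins
`T₁ = 0`, the averaged display pins `T₂ = 0` by uniqueness of level-free tables along good primes
(Literature `KMVPrimeAveragedSecondSqueeze`, p531103), and the envelope `Δ'/(2(1+Δ'))` exceeds `¼` beyond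
the diagonal. Also: the card's `C⁺` on any `(a, b)` with `a ≤ 1 < b` gives K_B through the same route
(`firstLemma_squeeze`, p527507, is the case `a = 1` through ALL of `C⁺`; here only its second-defect clause
at `(X², 1)` is consumed). A REDUCTION; stub A is NOT in print and is (A)-sensitive. No Petersson input.
«The programme SEARCHES and TYPES; no claim about Landau–Siegel zeros, Theorems 1–2 of
arXiv:2211.02515 or a repaired Margin232 until a kernel theorem says so.»
-/

open Polynomial

namespace Summit.Parity.GeneralizedHardyLittlewood.Theorems.BeyondDiagonalBeatsQuarter

open Literature.NumberTheory.LFunctions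

/-- **Stub A ⇒ K_B.** If, on some window `(1, b)`, the second defect at `(X², 1)` is `o(1)` on average
over the good primes of dyadic blocks (the registered signature of `stub_primeAveragedSecondDiagOnlyXSq`,
line `prime-averaged-squeeze`), then `BeyondDiagonalBeatsQuarter` holds: Bettin (antecedent) + the landed
`X²` main term ⇒ `T₁ = 0`; the averaged display + `MomentAsymptotics` ⇒ `T₂ = 0`; envelope `> ¼`. -/
theorem beyondDiagonalBeatsQuarter_of_primeAveragedSecondDiagOnlyXSq
    (hA : ∃ b : ℝ, 1 < b ∧ ∀ Δ' : ℝ, 1 < Δ' → Δ' < b → ∀ ε : ℝ, 0 < ε → ∃ N₀ : ℕ, ∀ N : ℕ, N₀ ≤ N →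
      ∑ q ∈ KMV2000.goodPrimes Δ' N, KMV2000.secondDefect (X ^ 2) 1 Δ' q ≤
        ε * (KMV2000.goodPrimes Δ' N).card) :
    Summit.Parity.GeneralizedHardyLittlewood.Theses.PrimeLevelFamEdge.BeyondDiagonalBeatsQuarter := by
  obtain ⟨b, hb, hav⟩ := hA
  unfold Summit.Parity.GeneralizedHardyLittlewood.Theses.PrimeLevelFamEdge.BeyondDiagonalBeatsQuarter
  intro hF
  exact KMV2000.beatsQuarter_of_bettin_of_secondDefect_average_X_sq hF
    Summit.Parity.GeneralizedHardyLittlewood.Theses.PrimeLevelFamEdge.stub_mollifierMainTermXSq hb hav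

/-- **`C⁺` on `(a, b)` with `a ≤ 1 < b` ⇒ K_B**, consuming only the second-defect clause of `C⁺` at
`(X², 1)` (`KMV2000.secondDefect_average_of_primeAveragedDiagOnly`) and Bettin for the first moment —
compare `Theorems.firstLemma_squeeze` (p527507: `a = 1`, all of `C⁺`, antecedent discarded). -/
theorem beyondDiagonalBeatsQuarter_of_primeAveragedDiagOnly_le_one
    (h : ∃ a b : ℝ, a ≤ 1 ∧ 1 < b ∧ KMV2000.PrimeAveragedDiagOnly a b) :
    Summit.Parity.GeneralizedHardyLittlewood.Theses.PrimeLevelFamEdge.BeyondDiagonalBeatsQuarter := by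
  obtain ⟨a, b, ha, hb, hav⟩ := h
  exact beyondDiagonalBeatsQuarter_of_primeAveragedSecondDiagOnlyXSq ⟨b, hb, fun _ h1 h2 ↦
    KMV2000.secondDefect_average_of_primeAveragedDiagOnly hav KMV2000.admissible_X_sq
      KMV2000.isEvenOrOdd_one (lt_of_le_of_lt ha h1) h2⟩

end Summit.Parity.GeneralizedHardyLittlewood.Theorems.BeyondDiagonalBeatsQuarter
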